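import Literature.AlgebraicGeometry.Resolution.NagataCriterion
import Mathlib.RingTheory.Localization.LocalizationLocalization
import Mathlib.RingTheory.Localization.Ideal
import HarnessLib

/-!
# Crux `FrobeniusLadder.FRationalResolution` (stmt-ResolutionOfSingularities-15317), line `redirect`,
# stub `stub_diagonalizableQuotientResolution` — transporting regularity of a quotient local ring from
# a localization `R_M` back to `R` (last plumbing step of (e-asm), memo MEMO-15317-leafhand2-g3 §6–§7)

`…StratumDescentPrime` delivers, on the model `R₀ = R_M` (`R = S₀`, `M` = powers of `e`), the
regularity of `(R_M/J)_{q₀/J}` for an ideal `J ⊆ q₀` of `R_M`. Kato's condition (2.1)(i) is phrased on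
`R` itself: `R_𝔮 ⧸ J' R_𝔮` with `𝔮 = q₀ ∩ R`, `J' = J ∩ R`. This file is the generic transport (no
grading): `R_𝔮 = (R_M)_{q₀}` (localization of a localization) and `J = J' R_M`.

* `map_under_map_eq` — `J' R_{𝔮}` and `J (R_M)_{q₀}` correspond under `R_𝔮 ≅ (R_M)_{q₀}`;
* **`isRegularLocalRing_atPrime_quotient_of_localization`** —
  `(R_M/J)_{q₀/J}` regular ⇒ `R_𝔮 ⧸ J' R_𝔮` regular.

Honest label: plumbing brick (no stub closed). No definitions, no named facts, no sorry. [folklore]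
-/

noncomputable section

-- single-problem summit: the doubled namespace component is forced
set_option linter.dupNamespace false

open Literature.AlgebraicGeometry.Resolution

namespace Summit.ResolutionOfSingularities.ResolutionOfSingularities.Theorems.FRationalResolution.LocalizationQuotientTransport

universe u

variable {R : Type u} [CommRing R] (M : Submonoid R)

/-- **Regularity of a quotient local ring transported from a localization.** `R_M = Localization M`,
`J ⊆ q₀` an ideal and a prime of `R_M`, `𝔮 = q₀ ∩ R`, `J' = J ∩ R`. If the local ring of `R_M ⧸ J` at
`q₀/J` is regular, then `R_𝔮 ⧸ J' R_𝔮` is a regular local ring. [folklore] -/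
theorem isRegularLocalRing_atPrime_quotient_of_localization (J q₀ : Ideal (Localization M))
    [q₀.IsPrime] (hJq : J ≤ q₀)
    (h : haveI : (q₀.map (Ideal.Quotient.mk J)).IsPrime := Ideal.isPrime_map_quotientMk_of_isPrime hJq
      IsRegularLocalRing (Localization.AtPrime (q₀.map (Ideal.Quotient.mk J)))) :
    IsRegularLocalRing (Localization.AtPrime (q₀.comap (algebraMap R (Localization M))) ⧸
      (J.comap (algebraMap R (Localization M))).map
        (algebraMap R (Localization.AtPrime (q₀.comap (algebraMap R (Localization M)))))) := by
  haveI : (q₀.map (Ideal.Quotient.mk J)).IsPrime := Ideal.isPrime_map_quotientMk_of_isPrime hJq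
  set 𝔮 : Ideal R := q₀.comap (algebraMap R (Localization M)) with h𝔮
  set J' : Ideal R := J.comap (algebraMap R (Localization M)) with hJ'
  -- (1) `(R_M/J)_{q₀/J} ≅ (R_M)_{q₀} / J`
  have h1 : IsRegularLocalRing (Localization.AtPrime q₀ ⧸
      J.map (algebraMap (Localization M) (Localization.AtPrime q₀))) :=
    (isRegularLocalRing_localization_quotient_iff J q₀ hJq).mpr h
  -- (2) `(R_M)_{q₀}` is `R` localized at `𝔮`
  let T := Localization.AtPrime q₀
  haveI : IsLocalization.AtPrime T 𝔮 :=
    IsLocalization.isLocalization_atPrime_localization_atPrime M q₀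
  let ψ : Localization.AtPrime 𝔮 ≃ₐ[R] T := IsLocalization.algEquiv 𝔮.primeCompl _ _
  -- (3) the ideals correspond
  have hJ : J = J'.map (algebraMap R (Localization M)) :=
    (IsLocalization.map_under (M := M) (Localization M) J).symm
  have hideal : J.map (algebraMap (Localization M) T) =
      (J'.map (algebraMap R (Localization.AtPrime 𝔮))).map (ψ : Localization.AtPrime 𝔮 →+* T) := by
    rw [hJ, Ideal.map_map, Ideal.map_map, ← IsScalarTower.algebraMap_eq]
    congr 1
    ext r
    simp
  -- (4) transport along the quotient isomorphism
  let θ := Ideal.quotientEquiv (J'.map (algebraMap R (Localization.AtPrime 𝔮)))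
    (J.map (algebraMap (Localization M) T)) (ψ : Localization.AtPrime 𝔮 ≃+* T) (by
      rw [hideal]; rfl)
  haveI := h1
  exact IsRegularLocalRing.of_ringEquiv (R := T ⧸ J.map (algebraMap (Localization M) T)) θ.symm

end Summit.ResolutionOfSingularities.ResolutionOfSingularities.Theorems.FRationalResolution.LocalizationQuotientTransport

end
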